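import Summits.FinalStateConjecture.FinalStateConjecture.Theses.PhaseMixingCapture
import Summits.FinalStateConjecture.FinalStateConjecture.Theses.GlobalAttraction
import Summits.FinalStateConjecture.FinalStateConjecture.Theorems.PhaseMixingCaptureCaptureSufficesTameKickReduction
import Literature.Geometry.Lorentzian.AdmissibleMGHDExistence
import HarnessLib

/-!
# `CaptureSufficesTame` (stmt-FinalStateConjecture-17270, route PhaseMixingCapture, rank 6),
# line `SketchIdeator2`: the bridge to route GlobalAttraction (lead c1, cycle 2, 2026-08-17)

The line's skeleton v2 (`Cruxes/CaptureSufficesTame/Lines/SketchIdeator2.lean`) has three registered stubs: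
A = item stmt-17296 `GlobalAttraction.CensoredExteriorsSettle` verbatim, U = item stmt-17298
`GlobalAttraction.SubextremalUpgrade` verbatim, and the kick R = `stub_unparkingKick` (un-parking kicks along
censored tame curves, local ∃-form). This file records, kernel-checked and definition-free, WHERE R SITS:

* `unparkingKick_of_genericCensorshipThirdLaw` — **R is implied by GlobalAttraction's items stmt-17297
  (`GenericCensorshipThirdLaw`: tame-generic third law, pointwise ∀-form) and stmt-9937 (`MGHDExists`,
  Choquet-Bruhat–Geroch)**. Proof: split on whether the base datum `F 0` has the third-law matrix. If it
  does, MGHD existence makes it censored and (∀ ⇒ ∃) un-parked, contradicting the kick's hypothesis; if it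
  does not, the pointwise tame-genericity witness of 17297 through `F 0` is the kick (every member off `0`
  has the third-law matrix, hence — with MGHD existence — is censored and un-parked; `ε₀ := 1`). The given
  censored base curve `F` is not used: the kick form is weaker than what 17297 supplies.
* `unparkingKick_of_genericCensorshipThirdLaw_of_choquetBruhatGeroch` — the same with `MGHDExists`
  discharged CONDITIONALLY from the named fact `choquetBruhat_geroch_exists_mghd_cauchy`
  (`AdmissibleMGHDExistence.lean`; trust base = Choquet-Bruhat–Geroch 1969, Thm. 3).
* `captureSufficesTame_of_globalAttraction` — consequently (and directly through GlobalAttraction's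
  deciding theorem `closes`) the crux follows from the four GlobalAttraction items: 17296 → 17297 → 17298 →
  9937 → `CaptureSufficesTame`; and `captureSufficesTame_of_globalAttraction_kick` — the line's own path:
  17296 → 17298 → R → `CaptureSufficesTame` via the landed reduction `finalStateConjecture_of_unparkingKick`,
  the crux's third hypothesis supplying the censored base curves (its first two stay idle).

Measure of the line, in one sentence: every registered stub reduces to an EXISTING open item of route
GlobalAttraction (A = 17296, U = 17298, R ⇐ 17297 + 9937), and the line is GlobalAttraction's `closes` with its
third-law input weakened from the pointwise ∀-form + MGHD existence to the relative ∃-form kick along censored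
curves (the only place the crux's own hypothesis `WeakCosmicCensorshipTame` is consumed). Nothing here is
analysis.
-/

set_option linter.dupNamespace false

noncomputable section

open scoped Manifold ContDiff Topology
open Set Function

namespace Summit.FinalStateConjecture.FinalStateConjecture.Theorems.PhaseMixingCaptureCaptureSufficesTame

open Literature.Geometry.Lorentzian
open Summit.FinalStateConjecture (HasCompleteNullInfinity exteriorOf RaysStayInClosure HasExhaustiveCharts
  IsFutureOriented)
open Summit.FinalStateConjecture.FinalStateConjecture.Theses

/-- **The kick stub R of line `SketchIdeator2` from GlobalAttraction's items 17297 + 9937.** If the third law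
is tame-generic pointwise in the ∀-form (`GlobalAttraction.GenericCensorshipThirdLaw`: through every admissible
datum some MGHD of which has incomplete `𝓘⁺` or an honest C⁰ endpoint configuration with an extremal hole passes
a tame injective immersed admissible curve all of whose other members have, for every MGHD, complete `𝓘⁺` and
only sub-extremal honest C⁰ configurations) and every admissible datum has an MGHD (`GlobalAttraction.MGHDExists`),
then the registered stub `stub_unparkingKick` holds verbatim: along every tame admissible curve of censored data
whose base is not (censored ∧ un-parked) there is a tame injective immersed admissible curve through the base whose
small members are censored and un-parked. Case split on the third-law matrix at the base datum; `ε₀ := 1`.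
[folklore] -/
theorem unparkingKick_of_genericCensorshipThirdLaw :
    GlobalAttraction.GenericCensorshipThirdLaw → GlobalAttraction.MGHDExists →
    ∀ (X : Type) [TopologicalSpace X] [ChartedSpace E3 X] [IsManifold (𝓡 3) ∞ X] [T2Space X]
      [SecondCountableTopology X] [ConnectedSpace X],
      ∀ (e : AFEnd X) (F : EuclideanSpace ℝ (Fin 1) → InitialDataSet (𝓡 3) X),
        InitialDataSet.IsTameDataFamily e 1 F →
          ((InitialDataSet.IsImmersedAtZero 1 F ∧ Function.Injective F) ∨ ∀ c, F c = F 0) →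
          (∀ c, F c ∈ admissibleVacuumData X) →
          (∀ c ≠ 0, (∃ 𝒟 : VacuumCauchyDevelopment (F c), 𝒟.IsMaximal) ∧
              ∀ 𝒟 : VacuumCauchyDevelopment (F c), 𝒟.IsMaximal →
                HasCompleteNullInfinity 𝒟.toCauchyDevelopment) →
          ¬ (((∃ 𝒟 : VacuumCauchyDevelopment (F 0), 𝒟.IsMaximal) ∧
                ∀ 𝒟 : VacuumCauchyDevelopment (F 0), 𝒟.IsMaximal →
                  HasCompleteNullInfinity 𝒟.toCauchyDevelopment) ∧
              ∀ 𝒟 : VacuumCauchyDevelopment (F 0), 𝒟.IsMaximal →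
                HasCompleteNullInfinity 𝒟.toCauchyDevelopment ∧
                  ((∃ (O : Set 𝒟.carrier) (d₀ : FinalStateDecomposition 𝒟.toSpacetime O 0),
                      O = exteriorOf 𝒟.toCauchyDevelopment d₀.charted ∧
                        RaysStayInClosure 𝒟.toCauchyDevelopment O ∧ HasExhaustiveCharts d₀ ∧
                          IsFutureOriented d₀) →
                    ∃ (O : Set 𝒟.carrier) (d : FinalStateDecomposition 𝒟.toSpacetime O 0),
                      (∀ i, Kerr.IsSubextremal (d.mass i) (d.spin i)) ∧
                        O = exteriorOf 𝒟.toCauchyDevelopment d.charted ∧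
                          RaysStayInClosure 𝒟.toCauchyDevelopment O ∧ HasExhaustiveCharts d ∧
                            IsFutureOriented d)) →
          ∃ (e' : AFEnd X) (F' : EuclideanSpace ℝ (Fin 1) → InitialDataSet (𝓡 3) X),
            InitialDataSet.IsTameDataFamily e' 1 F' ∧ F' 0 = F 0 ∧ Function.Injective F' ∧
              InitialDataSet.IsImmersedAtZero 1 F' ∧ (∀ c, F' c ∈ admissibleVacuumData X) ∧
              ∃ ε₀ > (0 : ℝ), ∀ c : EuclideanSpace ℝ (Fin 1), c ≠ 0 → ‖c‖ < ε₀ →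
                ((∃ 𝒟 : VacuumCauchyDevelopment (F' c), 𝒟.IsMaximal) ∧
                    ∀ 𝒟 : VacuumCauchyDevelopment (F' c), 𝒟.IsMaximal →
                      HasCompleteNullInfinity 𝒟.toCauchyDevelopment) ∧
                  ∀ 𝒟 : VacuumCauchyDevelopment (F' c), 𝒟.IsMaximal →
                    HasCompleteNullInfinity 𝒟.toCauchyDevelopment ∧
                      ((∃ (O : Set 𝒟.carrier) (d₀ : FinalStateDecomposition 𝒟.toSpacetime O 0),
                          O = exteriorOf 𝒟.toCauchyDevelopment d₀.charted ∧
                            RaysStayInClosure 𝒟.toCauchyDevelopment O ∧ HasExhaustiveCharts d₀ ∧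
                              IsFutureOriented d₀) →
                        ∃ (O : Set 𝒟.carrier) (d : FinalStateDecomposition 𝒟.toSpacetime O 0),
                          (∀ i, Kerr.IsSubextremal (d.mass i) (d.spin i)) ∧
                            O = exteriorOf 𝒟.toCauchyDevelopment d.charted ∧
                              RaysStayInClosure 𝒟.toCauchyDevelopment O ∧ HasExhaustiveCharts d ∧
                                IsFutureOriented d) := by
  intro hT hM X _ _ _ _ _ _ e F _hF _hdich hadm _hcens hbase
  -- the third-law matrix (item 17297's property) at a datum, and its upgrade to censored ∧ un-parked
  have key : ∀ D ∈ admissibleVacuumData X,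
      (∀ 𝒟 : VacuumCauchyDevelopment D, 𝒟.IsMaximal →
        HasCompleteNullInfinity 𝒟.toCauchyDevelopment ∧
          ∀ (O : Set 𝒟.carrier) (d : FinalStateDecomposition 𝒟.toSpacetime O 0),
            O = exteriorOf 𝒟.toCauchyDevelopment d.charted →
              RaysStayInClosure 𝒟.toCauchyDevelopment O → HasExhaustiveCharts d →
                IsFutureOriented d → ∀ i, Kerr.IsSubextremal (d.mass i) (d.spin i)) →
      ((∃ 𝒟 : VacuumCauchyDevelopment D, 𝒟.IsMaximal) ∧
          ∀ 𝒟 : VacuumCauchyDevelopment D, 𝒟.IsMaximal →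
            HasCompleteNullInfinity 𝒟.toCauchyDevelopment) ∧
        ∀ 𝒟 : VacuumCauchyDevelopment D, 𝒟.IsMaximal →
          HasCompleteNullInfinity 𝒟.toCauchyDevelopment ∧
            ((∃ (O : Set 𝒟.carrier) (d₀ : FinalStateDecomposition 𝒟.toSpacetime O 0),
                O = exteriorOf 𝒟.toCauchyDevelopment d₀.charted ∧
                  RaysStayInClosure 𝒟.toCauchyDevelopment O ∧ HasExhaustiveCharts d₀ ∧
                    IsFutureOriented d₀) →
              ∃ (O : Set 𝒟.carrier) (d : FinalStateDecomposition 𝒟.toSpacetime O 0),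
                (∀ i, Kerr.IsSubextremal (d.mass i) (d.spin i)) ∧
                  O = exteriorOf 𝒟.toCauchyDevelopment d.charted ∧
                    RaysStayInClosure 𝒟.toCauchyDevelopment O ∧ HasExhaustiveCharts d ∧
                      IsFutureOriented d) := by
    intro D hD h3
    refine ⟨⟨hM X D hD, fun 𝒟 hmax ↦ (h3 𝒟 hmax).1⟩, fun 𝒟 hmax ↦ ⟨(h3 𝒟 hmax).1, ?_⟩⟩
    rintro ⟨O, d₀, hO, hRay, hExh, hFut⟩
    exact ⟨O, d₀, (h3 𝒟 hmax).2 O d₀ hO hRay hExh hFut, hO, hRay, hExh, hFut⟩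
  by_cases h3 : ∀ 𝒟 : VacuumCauchyDevelopment (F 0), 𝒟.IsMaximal →
      HasCompleteNullInfinity 𝒟.toCauchyDevelopment ∧
        ∀ (O : Set 𝒟.carrier) (d : FinalStateDecomposition 𝒟.toSpacetime O 0),
          O = exteriorOf 𝒟.toCauchyDevelopment d.charted →
            RaysStayInClosure 𝒟.toCauchyDevelopment O → HasExhaustiveCharts d →
              IsFutureOriented d → ∀ i, Kerr.IsSubextremal (d.mass i) (d.spin i)
  · exact absurd (key (F 0) (hadm 0) h3) hbase
  · obtain ⟨e', F', hF', himm, h0, hinj, hadm', hE⟩ := hT X (F 0) ⟨hadm 0, h3⟩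
    refine ⟨e', F', hF', h0, hinj, himm, hadm', 1, one_pos, fun c hc _ ↦ ?_⟩
    exact key (F' c) (hadm' c) (Classical.not_not.mp fun h ↦ hE c hc ⟨hadm' c, h⟩)

/-- **The same with MGHD existence discharged conditionally from the named fact**
`choquetBruhat_geroch_exists_mghd_cauchy` (Choquet-Bruhat–Geroch, Comm. Math. Phys. 14 (1969), Thm. 3, p. 332),
through the tree corollary `choquetBruhat_geroch_exists_mghd_cauchy.forall_mem_admissibleVacuumData`, which is
`GlobalAttraction.MGHDExists` as a proposition. CONDITIONAL: trust base = that undischarged fact.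
[cite: ChoquetBruhatGeroch1969CMP, Thm. 3 (p. 332)] -/
theorem unparkingKick_of_genericCensorshipThirdLaw_of_choquetBruhatGeroch
    (hcbg : choquetBruhat_geroch_exists_mghd_cauchy) (hT : GlobalAttraction.GenericCensorshipThirdLaw) :
    ∀ (X : Type) [TopologicalSpace X] [ChartedSpace E3 X] [IsManifold (𝓡 3) ∞ X] [T2Space X]
      [SecondCountableTopology X] [ConnectedSpace X],
      ∀ (e : AFEnd X) (F : EuclideanSpace ℝ (Fin 1) → InitialDataSet (𝓡 3) X),
        InitialDataSet.IsTameDataFamily e 1 F →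
          ((InitialDataSet.IsImmersedAtZero 1 F ∧ Function.Injective F) ∨ ∀ c, F c = F 0) →
          (∀ c, F c ∈ admissibleVacuumData X) →
          (∀ c ≠ 0, (∃ 𝒟 : VacuumCauchyDevelopment (F c), 𝒟.IsMaximal) ∧
              ∀ 𝒟 : VacuumCauchyDevelopment (F c), 𝒟.IsMaximal →
                HasCompleteNullInfinity 𝒟.toCauchyDevelopment) →
          ¬ (((∃ 𝒟 : VacuumCauchyDevelopment (F 0), 𝒟.IsMaximal) ∧
                ∀ 𝒟 : VacuumCauchyDevelopment (F 0), 𝒟.IsMaximal →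
                  HasCompleteNullInfinity 𝒟.toCauchyDevelopment) ∧
              ∀ 𝒟 : VacuumCauchyDevelopment (F 0), 𝒟.IsMaximal →
                HasCompleteNullInfinity 𝒟.toCauchyDevelopment ∧
                  ((∃ (O : Set 𝒟.carrier) (d₀ : FinalStateDecomposition 𝒟.toSpacetime O 0),
                      O = exteriorOf 𝒟.toCauchyDevelopment d₀.charted ∧
                        RaysStayInClosure 𝒟.toCauchyDevelopment O ∧ HasExhaustiveCharts d₀ ∧
                          IsFutureOriented d₀) →
                    ∃ (O : Set 𝒟.carrier) (d : FinalStateDecomposition 𝒟.toSpacetime O 0),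
                      (∀ i, Kerr.IsSubextremal (d.mass i) (d.spin i)) ∧
                        O = exteriorOf 𝒟.toCauchyDevelopment d.charted ∧
                          RaysStayInClosure 𝒟.toCauchyDevelopment O ∧ HasExhaustiveCharts d ∧
                            IsFutureOriented d)) →
          ∃ (e' : AFEnd X) (F' : EuclideanSpace ℝ (Fin 1) → InitialDataSet (𝓡 3) X),
            InitialDataSet.IsTameDataFamily e' 1 F' ∧ F' 0 = F 0 ∧ Function.Injective F' ∧
              InitialDataSet.IsImmersedAtZero 1 F' ∧ (∀ c, F' c ∈ admissibleVacuumData X) ∧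
              ∃ ε₀ > (0 : ℝ), ∀ c : EuclideanSpace ℝ (Fin 1), c ≠ 0 → ‖c‖ < ε₀ →
                ((∃ 𝒟 : VacuumCauchyDevelopment (F' c), 𝒟.IsMaximal) ∧
                    ∀ 𝒟 : VacuumCauchyDevelopment (F' c), 𝒟.IsMaximal →
                      HasCompleteNullInfinity 𝒟.toCauchyDevelopment) ∧
                  ∀ 𝒟 : VacuumCauchyDevelopment (F' c), 𝒟.IsMaximal →
                    HasCompleteNullInfinity 𝒟.toCauchyDevelopment ∧
                      ((∃ (O : Set 𝒟.carrier) (d₀ : FinalStateDecomposition 𝒟.toSpacetime O 0),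
                          O = exteriorOf 𝒟.toCauchyDevelopment d₀.charted ∧
                            RaysStayInClosure 𝒟.toCauchyDevelopment O ∧ HasExhaustiveCharts d₀ ∧
                              IsFutureOriented d₀) →
                        ∃ (O : Set 𝒟.carrier) (d : FinalStateDecomposition 𝒟.toSpacetime O 0),
                          (∀ i, Kerr.IsSubextremal (d.mass i) (d.spin i)) ∧
                            O = exteriorOf 𝒟.toCauchyDevelopment d.charted ∧
                              RaysStayInClosure 𝒟.toCauchyDevelopment O ∧ HasExhaustiveCharts d ∧
                                IsFutureOriented d) :=
  unparkingKick_of_genericCensorshipThirdLaw hT fun X _ _ _ _ _ _ ↦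
    hcbg.forall_mem_admissibleVacuumData X

/-- **The crux from GlobalAttraction's four items** (cross-route implication record): GlobalAttraction's
deciding theorem `closes` gives the summit from 17296, 17297, 17298, 9937, and the summit implies the
conditional crux `CaptureSufficesTame` (all three of its hypotheses dropped). [folklore] -/
theorem captureSufficesTame_of_globalAttraction (h₁ : GlobalAttraction.CensoredExteriorsSettle)
    (h₂ : GlobalAttraction.GenericCensorshipThirdLaw) (h₃ : GlobalAttraction.SubextremalUpgrade)
    (h₄ : GlobalAttraction.MGHDExists) : PhaseMixingCapture.CaptureSufficesTame :=
  fun _ _ _ ↦ GlobalAttraction.closes h₁ h₂ h₃ h₄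

/-- **The line's own path to the crux** (skeleton v2 composition over landed files only): GlobalAttraction's
items 17296 (stub A) and 17298 (stub U), VERBATIM the first two analytic hypotheses of the landed reduction
`finalStateConjecture_of_unparkingKick`, plus the kick stub R, give `CaptureSufficesTame` — the crux's third
hypothesis `WeakCosmicCensorshipTame` is the reduction's `hW` (source of censored base curves), its first two
are idle. With `unparkingKick_of_genericCensorshipThirdLaw` this recovers `captureSufficesTame_of_globalAttraction`
along the line's composition instead of GlobalAttraction's. [folklore] -/
theorem captureSufficesTame_of_globalAttraction_kick (hA : GlobalAttraction.CensoredExteriorsSettle)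
    (hU : GlobalAttraction.SubextremalUpgrade)
    (hR : ∀ (X : Type) [TopologicalSpace X] [ChartedSpace E3 X] [IsManifold (𝓡 3) ∞ X] [T2Space X]
        [SecondCountableTopology X] [ConnectedSpace X],
        ∀ (e : AFEnd X) (F : EuclideanSpace ℝ (Fin 1) → InitialDataSet (𝓡 3) X),
          InitialDataSet.IsTameDataFamily e 1 F →
            ((InitialDataSet.IsImmersedAtZero 1 F ∧ Function.Injective F) ∨ ∀ c, F c = F 0) →
            (∀ c, F c ∈ admissibleVacuumData X) →
            (∀ c ≠ 0, (∃ 𝒟 : VacuumCauchyDevelopment (F c), 𝒟.IsMaximal) ∧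
                ∀ 𝒟 : VacuumCauchyDevelopment (F c), 𝒟.IsMaximal →
                  HasCompleteNullInfinity 𝒟.toCauchyDevelopment) →
            ¬ (((∃ 𝒟 : VacuumCauchyDevelopment (F 0), 𝒟.IsMaximal) ∧
                  ∀ 𝒟 : VacuumCauchyDevelopment (F 0), 𝒟.IsMaximal →
                    HasCompleteNullInfinity 𝒟.toCauchyDevelopment) ∧
                ∀ 𝒟 : VacuumCauchyDevelopment (F 0), 𝒟.IsMaximal →
                  HasCompleteNullInfinity 𝒟.toCauchyDevelopment ∧
                    ((∃ (O : Set 𝒟.carrier) (d₀ : FinalStateDecomposition 𝒟.toSpacetime O 0),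
                        O = exteriorOf 𝒟.toCauchyDevelopment d₀.charted ∧
                          RaysStayInClosure 𝒟.toCauchyDevelopment O ∧ HasExhaustiveCharts d₀ ∧
                            IsFutureOriented d₀) →
                      ∃ (O : Set 𝒟.carrier) (d : FinalStateDecomposition 𝒟.toSpacetime O 0),
                        (∀ i, Kerr.IsSubextremal (d.mass i) (d.spin i)) ∧
                          O = exteriorOf 𝒟.toCauchyDevelopment d.charted ∧
                            RaysStayInClosure 𝒟.toCauchyDevelopment O ∧ HasExhaustiveCharts d ∧
                              IsFutureOriented d)) →
            ∃ (e' : AFEnd X) (F' : EuclideanSpace ℝ (Fin 1) → InitialDataSet (𝓡 3) X),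
              InitialDataSet.IsTameDataFamily e' 1 F' ∧ F' 0 = F 0 ∧ Function.Injective F' ∧
                InitialDataSet.IsImmersedAtZero 1 F' ∧ (∀ c, F' c ∈ admissibleVacuumData X) ∧
                ∃ ε₀ > (0 : ℝ), ∀ c : EuclideanSpace ℝ (Fin 1), c ≠ 0 → ‖c‖ < ε₀ →
                  ((∃ 𝒟 : VacuumCauchyDevelopment (F' c), 𝒟.IsMaximal) ∧
                      ∀ 𝒟 : VacuumCauchyDevelopment (F' c), 𝒟.IsMaximal →
                        HasCompleteNullInfinity 𝒟.toCauchyDevelopment) ∧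
                    ∀ 𝒟 : VacuumCauchyDevelopment (F' c), 𝒟.IsMaximal →
                      HasCompleteNullInfinity 𝒟.toCauchyDevelopment ∧
                        ((∃ (O : Set 𝒟.carrier) (d₀ : FinalStateDecomposition 𝒟.toSpacetime O 0),
                            O = exteriorOf 𝒟.toCauchyDevelopment d₀.charted ∧
                              RaysStayInClosure 𝒟.toCauchyDevelopment O ∧ HasExhaustiveCharts d₀ ∧
                                IsFutureOriented d₀) →
                          ∃ (O : Set 𝒟.carrier) (d : FinalStateDecomposition 𝒟.toSpacetime O 0),
                            (∀ i, Kerr.IsSubextremal (d.mass i) (d.spin i)) ∧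
                              O = exteriorOf 𝒟.toCauchyDevelopment d.charted ∧
                                RaysStayInClosure 𝒟.toCauchyDevelopment O ∧ HasExhaustiveCharts d ∧
                                  IsFutureOriented d)) :
    PhaseMixingCapture.CaptureSufficesTame :=
  fun _ _ hW ↦ finalStateConjecture_of_unparkingKick hW hA hU hR

/-- Sanity composition: GlobalAttraction's four items give the crux ALSO along the line's path. -/
example (h₁ : GlobalAttraction.CensoredExteriorsSettle) (h₂ : GlobalAttraction.GenericCensorshipThirdLaw)
    (h₃ : GlobalAttraction.SubextremalUpgrade) (h₄ : GlobalAttraction.MGHDExists) :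
    PhaseMixingCapture.CaptureSufficesTame :=
  captureSufficesTame_of_globalAttraction_kick h₁ h₃ (unparkingKick_of_genericCensorshipThirdLaw h₂ h₄)

end Summit.FinalStateConjecture.FinalStateConjecture.Theorems.PhaseMixingCaptureCaptureSufficesTame

end
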